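import Summits.AtomisticToContinuum.Crystallization.Theses.FrustrationRangeCertificates

/-!
# `CertificatesDefectVanish` — the positional hinge of route FrustrationRangeCertificates

Support item stmt-AtomisticToContinuum-12977 of route `FrustrationRangeCertificates`
(sub-problem `Crystallization` of `AtomisticToContinuum`):

  `PatternPricedCertificates → TrialStateUpper → BulkDefectVanish`,

with the reference periodic configuration `P` of `PatternPricedCertificates`. Pure counting:
fix `R, ε`, a sequence of Lennard-Jones ground states `x N` and `η > 0`. The certificate at
`(R, ε, θ := η/2)` gives `δ, L, c, κ ∈ (0, 1], Φ, Q`; every ground state is `δ`-separated, so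
the pointwise inequality `c + κ·1[bad i] ≤ ½·(site energy of i) + (transfer balance of i)`
holds at every particle of `x N`. Summing over `i`, the antisymmetric transfers cancel and the
half site energies add up to the interaction energy `E(N)` (`two_mul_interactionEnergy`), so
`N·c + κ·#bad_N ≤ E(N)`. `TrialStateUpper` at the witness `Q` with `ε' := κη/2` gives
`E(N)/N ≤ e(Q) + ε' ≤ c + κθ + ε' = c + κη` eventually, whence `#bad_N/N ≤ η` eventually; as
`#bad_N/N ≥ 0`, the defect fraction tends to `0`.
-/

open scoped BigOperators Topology Classical
open Filter

namespace Summit.AtomisticToContinuum.Crystallization.Theorems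

open Literature.MathematicalPhysics.StatisticalMechanics
open Summit.AtomisticToContinuum.Crystallization.Theses.FrustrationRangeCertificates

/-- Transfers are zero-sum: an antisymmetrised double sum over ordered pairs `j ≠ i` of a finite
index type vanishes. [folklore] -/
theorem certificatesDefectVanish_sum_sum_erase_sub {N : ℕ} (g : Fin N → Fin N → ℝ) :
    ∑ i, ∑ j ∈ Finset.univ.erase i, (g i j - g j i) = 0 := by
  have h : ∀ i : Fin N, ∑ j ∈ Finset.univ.erase i, (g i j - g j i) = ∑ j, (g i j - g j i) :=
    fun i => by rw [Finset.sum_erase_eq_sub (Finset.mem_univ i), sub_self, sub_zero]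
  simp only [h, Finset.sum_sub_distrib]
  exact sub_eq_zero.2 Finset.sum_comm

/-- Half site energies sum to the interaction energy: `Σ_i ½ Σ_{j ≠ i} V(|x_i − x_j|) = 𝓔_N(x)`
(double counting, `two_mul_interactionEnergy`). [folklore] -/
theorem certificatesDefectVanish_sum_half_siteEnergy {d N : ℕ} (V : ℝ → ℝ)
    (x : Fin N → EuclideanSpace ℝ (Fin d)) :
    ∑ i, (∑ j ∈ Finset.univ.erase i, V (dist (x i) (x j))) / 2 = interactionEnergy V x := by
  rw [← Finset.sum_div]
  have h := two_mul_interactionEnergy V x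
  simp only [siteEnergy] at h
  rw [← h]
  ring

/-- Summing a pattern-priced certificate's right-hand side over a finite configuration: the
transfer balances cancel and the half site energies give the interaction energy. [folklore] -/
theorem certificatesDefectVanish_sum_rhs {d N : ℕ} (V : ℝ → ℝ)
    (x : Fin N → EuclideanSpace ℝ (Fin d)) (pat : Fin N → Finset (EuclideanSpace ℝ (Fin d)))
    (Φ : EuclideanSpace ℝ (Fin d) → Finset (EuclideanSpace ℝ (Fin d)) →
      Finset (EuclideanSpace ℝ (Fin d)) → ℝ) :
    ∑ i, ((∑ j ∈ Finset.univ.erase i, V (dist (x i) (x j))) / 2 +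
        ∑ j ∈ Finset.univ.erase i,
          (Φ (x j - x i) (pat i) (pat j) - Φ (x i - x j) (pat j) (pat i))) =
      interactionEnergy V x := by
  rw [Finset.sum_add_distrib, certificatesDefectVanish_sum_half_siteEnergy,
    certificatesDefectVanish_sum_sum_erase_sub (fun i j => Φ (x j - x i) (pat i) (pat j)),
    add_zero]

/-- The counting step: if `c + κ·1[¬ good i]` summed over the `N ≥ 1` particles is at most `E`
and `E/N ≤ c + κη` with `κ > 0`, then the fraction of bad particles is at most `η`. [folklore] -/
theorem certificatesDefectVanish_card_div_le {N : ℕ} (hN : 0 < N) {c κ η E : ℝ} (hκ : 0 < κ)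
    (good : Fin N → Prop) (h1 : ∑ i, (c + (if good i then 0 else κ)) ≤ E)
    (hE : E / N ≤ c + κ * η) :
    (Nat.card {i : Fin N // ¬ good i} : ℝ) / N ≤ η := by
  have hNr : (0 : ℝ) < N := by exact_mod_cast hN
  rw [div_le_iff₀ hNr] at hE ⊢
  simp only [Finset.sum_add_distrib, Finset.sum_const, Finset.card_univ, Fintype.card_fin,
    nsmul_eq_mul, Finset.sum_ite] at h1
  rw [Nat.card_eq_fintype_card, Fintype.card_subtype]
  refine le_of_mul_le_mul_right ?_ hκ
  linarith

/-- A non-negative real sequence which is eventually below every positive level tends to `0`.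
[folklore] -/
theorem certificatesDefectVanish_tendsto_zero {u : ℕ → ℝ} (h0 : ∀ N, 0 ≤ u N)
    (h : ∀ η : ℝ, 0 < η → ∀ᶠ N in atTop, u N ≤ η) : Tendsto u atTop (𝓝 0) := by
  refine tendsto_order.2 ⟨fun a ha => Eventually.of_forall fun N => ha.trans_le (h0 N),
    fun a ha => ?_⟩
  filter_upwards [h (a / 2) (half_pos ha)] with N hN
  linarith

/-- **Item stmt-AtomisticToContinuum-12977 (`CertificatesDefectVanish`, positional hinge of route
FrustrationRangeCertificates).** Pattern-priced transfer certificates at finite level together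
with the trial-state upper bound `E(N)/N ≤ e(Q) + ε'` give `BulkDefectVanish` with the
certificates' reference configuration `P`: along every sequence of Lennard-Jones ground states
all but `o(N)` particles have their `(R, ε)`-pattern matched both ways to an isometric copy of
`P`'s. Proof by counting: `N·c + κ·#bad_N ≤ E(N) ≤ N·(c + κη)` eventually.
[route FrustrationRangeCertificates, support item; BlancLewin2015 §2.3 for context] -/
theorem certificatesDefectVanish_proof : CertificatesDefectVanish := by
  unfold CertificatesDefectVanish
  intro hX hU
  obtain ⟨P, hP⟩ := hX
  refine ⟨P, fun R ε hR hε x hx => ?_⟩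
  refine certificatesDefectVanish_tendsto_zero (fun N => by positivity) fun η hη => ?_
  obtain ⟨δ, L, c, κ, Φ, Q, _hδ, hκ, _hκ1, hsep, hQ, hcert⟩ :=
    hP R ε (η / 2) hR hε (half_pos hη)
  filter_upwards [hU Q (κ * η / 2) (by positivity), Filter.eventually_gt_atTop 0] with N hN hN0
  have hgs : IsGroundState lennardJones (x N) := hx N
  have hc := hcert N (x N) (hsep N (x N) hgs)
  refine certificatesDefectVanish_card_div_le hN0 hκ _
    ((Finset.sum_le_sum fun i _ => hc i).trans_eq
      (certificatesDefectVanish_sum_rhs lennardJones (x N) _ Φ)) ?_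
  rw [hgs.2]
  linarith
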